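import Summits.KontsevichZagierPeriods.Zeta5Search.LaiSweepShard

/-!
# `κ₃` sweep certificate — shard file 100 of 127 (shards 700–706 of 889)

HONEST FRAMING. Systematic search; no irrationality claim unless certified. This file only checks,
by `decide +kernel`, shards 700–706 of the order-cell sweep of the `κ₃` point `(74, 2180, 444; δ74)`
(engine `LaiSweepEngine`, soundness `LaiSweepJump/Free/Eval/Shard/Kappa3`; a shard is `⟨regime, n,
p, q, p', q', Lo, Up⟩`: `n` cells from `p/q` to `p'/q'` with integer rate sums in `[Lo, Up]`, `K =
128`, `D = 2^40`). It draws NO conclusion: only the capstone `LaiKappa3SweepCert`, which needs all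
127 shard files, does. Kernel cost of this file ≈ 560 cells × 0.3 s.
-/

namespace Summit.KontsevichZagierPeriods.Zeta5Search.Sweep

set_option maxHeartbeats 100000000 in
/-- Shard 700: 80 cells of regime B from `286/375` to `233/305`.
[cite: Lai2024BallRivoal, §4 Lemma 4.3] -/
theorem shard700 :
    Shard.check 128 (2^40)
      ⟨true, 80, 286, 375, 233, 305, 11538591987015, 17394581602357⟩ = true := by
  decide +kernel

set_option maxHeartbeats 100000000 in
/-- Shard 701: 80 cells of regime B from `233/305` to `189/247`.
[cite: Lai2024BallRivoal, §4 Lemma 4.3] -/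
theorem shard701 :
    Shard.check 128 (2^40)
      ⟨true, 80, 233, 305, 189, 247, 11345205863091, 17121195257628⟩ = true := by
  decide +kernel

set_option maxHeartbeats 100000000 in
/-- Shard 702: 80 cells of regime B from `189/247` to `233/304`.
[cite: Lai2024BallRivoal, §4 Lemma 4.3] -/
theorem shard702 :
    Shard.check 128 (2^40)
      ⟨true, 80, 189, 247, 233, 304, 11498633990858, 17370883430821⟩ = true := by
  decide +kernel

set_option maxHeartbeats 100000000 in
/-- Shard 703: 80 cells of regime B from `233/304` to `271/353`.
[cite: Lai2024BallRivoal, §4 Lemma 4.3] -/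
theorem shard703 :
    Shard.check 128 (2^40)
      ⟨true, 80, 233, 304, 271, 353, 11422770507178, 17274558541802⟩ = true := by
  decide +kernel

set_option maxHeartbeats 100000000 in
/-- Shard 704: 80 cells of regime B from `271/353` to `183/238`.
[cite: Lai2024BallRivoal, §4 Lemma 4.3] -/
theorem shard704 :
    Shard.check 128 (2^40)
      ⟨true, 80, 271, 353, 183, 238, 10907719735917, 16512602067553⟩ = true := by
  decide +kernel

set_option maxHeartbeats 100000000 in
/-- Shard 705: 80 cells of regime B from `183/238` to `305/396`.
[cite: Lai2024BallRivoal, §4 Lemma 4.3] -/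
theorem shard705 :
    Shard.check 128 (2^40)
      ⟨true, 80, 183, 238, 305, 396, 11723184028842, 17765851168176⟩ = true := by
  decide +kernel

set_option maxHeartbeats 100000000 in
/-- Shard 706: 80 cells of regime B from `305/396` to `260/337`.
[cite: Lai2024BallRivoal, §4 Lemma 4.3] -/
theorem shard706 :
    Shard.check 128 (2^40)
      ⟨true, 80, 305, 396, 260, 337, 11866618198523, 18002717441346⟩ = true := by
  decide +kernel

/-- The checked shards of this file, in order. [folklore] -/
def shards100 : List (CheckedShard 128 (2^40)) :=
  [⟨_, shard700⟩, ⟨_, shard701⟩, ⟨_, shard702⟩, ⟨_, shard703⟩, ⟨_, shard704⟩,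
    ⟨_, shard705⟩, ⟨_, shard706⟩]

end Summit.KontsevichZagierPeriods.Zeta5Search.Sweep
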